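import Mathlib
import Summits.Ventures.HodgeRepro2.T5TraceDualConductor
import Summits.Ventures.HodgeRepro2.T5ConductorComposite

/-!
# The conductor formula `n(ψ_F ∘ Tr_{E/F}) = e · n(ψ_F) + d`

Tier-5 support for the (A6) step of §N5.12.6 / §N5.13.2 (route/T5-route-2.md l. 599): the
classical conductor formula for the composite additive character `ψ_E := ψ_F ∘ Tr_{E/F}`, with
`e` the ramification index and `d` the different exponent of `E_v / F_v`, assembled from

* `T5TraceDualConductor.trace_span_singleton_le_one_iff_exp` (p394400): for `y ∈ L` with
  `v_E y = exp (-k)` and `𝔇 = (x)` with `v_E x = exp (-d)`, `Tr (B ∙ y) ⊆ A ⟺ 0 ≤ d + k`;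
* `T5ConductorComposite.conductorExp_comp_trace_eq` (p395064): the conductor bookkeeping,
  which turns the TRACE–BALL RELATION «`Tr (P_E^{-m}) ⊆ P_F^{-n} ⟺ m ≤ e n + d`» into the formula.

This file proves the trace–ball relation (`forall_val_trace_le_iff`) from p394400 by reading the
balls as principal `B`-submodules (`B` the valuation ring of `v_E`) and scaling by `ϖ^n`, and
concludes (`conductorExp_comp_trace_eq`).  Setting: Mathlib's AKLB (`B` the integral closure of
`A` in the finite separable `L / K`, `A` integrally closed, `B` Dedekind), `A` = valuation ring of
`v_F`, `B` = valuation ring of `v_E`, `v_F ϖ = exp (-1)`, `v_E ϖ = exp (-e)`, `v_E π = exp (-1)`,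
`𝔇 = (x)` with `v_E x = exp (-d)`, `ψ_F` trivial on some ball and non-trivial.

Uses an L-value-free non-vanishing device: NO.
-/

namespace Summit.Ventures.HodgeRepro2.T5ConductorFormula

open WithZero

/-! ### 1. Balls of `L` as principal `B`-submodules -/

section Balls

variable {B L : Type*} [CommRing B] [Field L] [Algebra B L]
  (vE : Valuation L (WithZero (Multiplicative ℤ)))

/-- With `B` the valuation ring of `v_E`, the principal `B`-submodule `B ∙ y` is the ball
`{z ∣ v_E z ≤ v_E y}`. -/
theorem mem_span_singleton_iff_val_le (hB : vE.Integers B) {y : L} (hy : y ≠ 0) (z : L) :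
    z ∈ (B ∙ y) ↔ vE z ≤ vE y := by
  rw [Submodule.mem_span_singleton]
  constructor
  · rintro ⟨b, rfl⟩
    rw [Algebra.smul_def, Valuation.map_mul]
    calc vE (algebraMap B L b) * vE y ≤ 1 * vE y := mul_le_mul' (hB.map_le_one b) le_rfl
      _ = vE y := one_mul _
  · intro hz
    have h1 : vE (z / y) ≤ 1 := by
      rw [Valuation.map_div]
      exact div_le_one_of_le₀ hz zero_le
    obtain ⟨b, hb⟩ := hB.exists_of_le_one h1
    exact ⟨b, by rw [Algebra.smul_def, hb, div_mul_cancel₀ z hy]⟩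

/-- The ball `P_E^{-m}` is `B ∙ y` for any `y` with `v_E y = exp m`. -/
theorem mem_span_singleton_iff_val_le_exp (hB : vE.Integers B) {y : L} {m : ℤ}
    (hy : vE y = exp m) (z : L) : z ∈ (B ∙ y) ↔ vE z ≤ exp m := by
  have hy0 : y ≠ 0 := by
    rintro rfl
    rw [Valuation.map_zero] at hy
    exact exp_ne_zero hy.symm
  rw [mem_span_singleton_iff_val_le vE hB hy0, hy]

end Balls

/-! ### 2. Scaling lemmas -/

section Scaling

variable {A K L : Type*} [CommRing A] [Field K] [Field L] [Algebra A K] [Algebra K L]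
  (vF : Valuation K (WithZero (Multiplicative ℤ))) (vE : Valuation L (WithZero (Multiplicative ℤ)))

/-- Scaling by `ϖ^n`: `v_F (Tr (ϖ^n • z)) ≤ 1 ⟺ v_F (Tr z) ≤ exp n`. -/
theorem val_trace_zpow_smul_le_one_iff (ϖ : A) (hϖF : vF (algebraMap A K ϖ) = exp (-1 : ℤ))
    (n : ℤ) (z : L) :
    vF (Algebra.trace K L ((algebraMap A K ϖ ^ n) • z)) ≤ 1 ↔
      vF (Algebra.trace K L z) ≤ exp n := by
  rw [LinearMap.map_smul, smul_eq_mul, Valuation.map_mul, map_zpow₀, hϖF, ← exp_zsmul]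
  have h : exp (n • (-1 : ℤ)) = (exp n)⁻¹ := by
    rw [← exp_neg]
    congr 1
    simp
  rw [h, inv_mul_le_iff₀ exp_pos, mul_one]

variable [Algebra A L] [IsScalarTower A K L]

/-- `v_E (ϖ^n • z) = exp (-(e n)) · v_E z` when `v_E ϖ = exp (-e)`. -/
theorem val_zpow_smul (ϖ : A) (e : ℤ) (hϖE : vE (algebraMap A L ϖ) = exp (-e)) (n : ℤ)
    (z : L) : vE ((algebraMap A K ϖ ^ n) • z) = exp (-(e * n)) * vE z := by
  rw [Algebra.smul_def, map_zpow₀, ← IsScalarTower.algebraMap_apply, Valuation.map_mul, map_zpow₀,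
    hϖE, ← exp_zsmul]
  have h : exp (n • (-e)) = exp (-(e * n)) := by
    congr 1
    rw [smul_eq_mul]
    ring
  rw [h]

end Scaling

/-! ### 3. The trace–ball relation from the trace dual -/

section Trace

variable (A K L B : Type*) [CommRing A] [Field K] [CommRing B] [Field L]
  [Algebra A K] [Algebra B L] [Algebra A B] [Algebra K L] [Algebra A L]
  [IsScalarTower A K L] [IsScalarTower A B L]
  [IsDomain A] [IsFractionRing A K] [FiniteDimensional K L] [Algebra.IsSeparable K L]
  [IsIntegralClosure B A L] [IsIntegrallyClosed A] [IsDedekindDomain B]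
  [Module.IsTorsionFree A B] [IsFractionRing B L]
  (vF : Valuation K (WithZero (Multiplicative ℤ))) (vE : Valuation L (WithZero (Multiplicative ℤ)))

omit [IsDomain A] [IsFractionRing A K] [FiniteDimensional K L] [Algebra.IsSeparable K L]
  [IsIntegralClosure B A L] [IsIntegrallyClosed A] [IsDedekindDomain B]
  [Module.IsTorsionFree A B] [IsFractionRing B L] in
/-- «`Tr(I) ⊆ A`» as a pointwise valuation condition, `A` the valuation ring of `v_F`. -/
theorem trace_map_le_one_iff_forall_val_le (hA : vF.Integers A) (I : Submodule B L) :
    Submodule.map ((Algebra.trace K L).restrictScalars A) (Submodule.restrictScalars A I) ≤ 1 ↔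
      ∀ z ∈ I, vF (Algebra.trace K L z) ≤ 1 := by
  rw [Submodule.map_le_iff_le_comap]
  constructor
  · intro h z hz
    have := h (show z ∈ Submodule.restrictScalars A I from hz)
    rw [Submodule.mem_comap, LinearMap.restrictScalars_apply, Submodule.mem_one] at this
    obtain ⟨a, ha⟩ := this
    rw [← ha]
    exact hA.map_le_one a
  · intro h z hz
    rw [Submodule.mem_comap, LinearMap.restrictScalars_apply, Submodule.mem_one]
    exact hA.exists_of_le_one (h z hz)

/-- THE TRACE–BALL RELATION: «`Tr (P_E^{-m}) ⊆ P_F^{-n}` ⟺ `m ≤ e n + d`», from the trace dual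
(p394400) with the balls read as principal `B`-submodules and scaled by `ϖ^n`. -/
theorem forall_val_trace_le_iff (hA : vF.Integers A) (hB : vE.Integers B)
    (ϖ : A) (hϖF : vF (algebraMap A K ϖ) = exp (-1 : ℤ)) (e : ℤ)
    (hϖE : vE (algebraMap A L ϖ) = exp (-e))
    (π : B) (hπ : vE (algebraMap B L π) = exp (-1 : ℤ))
    (x : B) (hx : differentIdeal A B = Ideal.span {x}) (hx0 : x ≠ 0) (d : ℤ)
    (hxd : vE (algebraMap B L x) = exp (-d)) (m n : ℤ) :
    (∀ z : L, vE z ≤ exp m → vF (Algebra.trace K L z) ≤ exp n) ↔ m ≤ e * n + d := by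
  have hϖK0 : algebraMap A K ϖ ≠ 0 :=
    (Valuation.ne_zero_iff vF).mp (by rw [hϖF]; exact exp_ne_zero)
  have hy'v : vE (algebraMap B L π ^ (e * n - m)) = exp (-(e * n - m)) := by
    rw [map_zpow₀, hπ, ← exp_zsmul]
    congr 1
    simp
  have key := T5TraceDualConductor.trace_span_singleton_le_one_iff_exp A K L B vE hB x hx hx0 d
    hxd (algebraMap B L π ^ (e * n - m)) (e * n - m) hy'v
  rw [trace_map_le_one_iff_forall_val_le A K L B vF hA] at key
  constructor
  · intro H
    have hmem : ∀ w ∈ (B ∙ (algebraMap B L π ^ (e * n - m))), vF (Algebra.trace K L w) ≤ 1 := by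
      intro w hw
      rw [mem_span_singleton_iff_val_le_exp vE hB hy'v] at hw
      have hz : vE ((algebraMap A K ϖ ^ (-n)) • w) ≤ exp m := by
        rw [val_zpow_smul vE ϖ e hϖE (-n) w]
        calc exp (-(e * -n)) * vE w ≤ exp (-(e * -n)) * exp (-(e * n - m)) :=
              mul_le_mul' le_rfl hw
          _ = exp m := by rw [← exp_add]; congr 1; ring
      have hw_eq : w = (algebraMap A K ϖ ^ n) • ((algebraMap A K ϖ ^ (-n)) • w) := by
        rw [smul_smul, ← zpow_add₀ hϖK0, add_neg_cancel, zpow_zero, one_smul]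
      rw [hw_eq, val_trace_zpow_smul_le_one_iff vF ϖ hϖF n]
      exact H _ hz
    have := key.mp hmem
    omega
  · intro H z hz
    have h1 := key.mpr (by omega)
    have hw : (algebraMap A K ϖ ^ n) • z ∈ (B ∙ (algebraMap B L π ^ (e * n - m))) := by
      rw [mem_span_singleton_iff_val_le_exp vE hB hy'v, val_zpow_smul vE ϖ e hϖE n z]
      calc exp (-(e * n)) * vE z ≤ exp (-(e * n)) * exp m := mul_le_mul' le_rfl hz
        _ = exp (-(e * n - m)) := by rw [← exp_add]; congr 1; ring
    have := h1 _ hw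
    rwa [val_trace_zpow_smul_le_one_iff vF ϖ hϖF n] at this

/-! ### 4. The conductor formula -/

/-- THE CONDUCTOR FORMULA `n(ψ_F ∘ Tr_{L/K}) = e · n(ψ_F) + d` in the AKLB setting, with
`A`, `B` the valuation rings of `v_F`, `v_E`. -/
theorem conductorExp_comp_trace_eq {M : Type*} [Monoid M] (ψ : AddChar K M)
    (hA : vF.Integers A) (hB : vE.Integers B)
    (ϖ : A) (hϖF : vF (algebraMap A K ϖ) = exp (-1 : ℤ)) (e : ℤ)
    (hϖE : vE (algebraMap A L ϖ) = exp (-e))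
    (π : B) (hπ : vE (algebraMap B L π) = exp (-1 : ℤ))
    (x : B) (hx : differentIdeal A B = Ideal.span {x}) (hx0 : x ≠ 0) (d : ℤ)
    (hxd : vE (algebraMap B L x) = exp (-d))
    (h₀ : ∃ k : ℤ, ∀ y : K, vF y ≤ exp k → ψ y = 1) (hψ : ∃ y : K, ψ y ≠ 1) :
    T5AdditiveConductor.conductorExp (ψ.compAddMonoidHom (Algebra.trace K L).toAddMonoidHom) vE =
      e * T5AdditiveConductor.conductorExp ψ vF + d :=
  T5ConductorComposite.conductorExp_comp_trace_eq vF vE ψ hA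
    (fun a => by rw [IsScalarTower.algebraMap_apply A B L]; exact hB.map_le_one _) h₀ hψ e d
    (fun m n => forall_val_trace_le_iff A K L B vF vE hA hB ϖ hϖF e hϖE π hπ x hx hx0 d hxd m n)

end Trace

end Summit.Ventures.HodgeRepro2.T5ConductorFormula
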